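import Mathlib.RingTheory.RootsOfUnity.Complex
import Mathlib.RingTheory.Polynomial.Cyclotomic.Roots
import Literature.NumberTheory.EllipticCurves.TwoVariablePAdicLFunctionK
import Literature.NumberTheory.EllipticCurves.CyclotomicInterpolantUniquenessProofs
import HarnessLib

/-!
# Uniqueness of the two-variable `p`-adic `L`-function of `E/ℚ` over `K`

Topic `Literature/NumberTheory/EllipticCurves`. THEOREMS ONLY: no definitions, no named facts.
`TwoVariablePAdicLFunctionK.lean` states Perrin-Riou's / Nekovář's two-variable `p`-adic
`L`-function `L_p(f ⊗ K, 𝟙)` on the `ℤ_p²`-extension of `K` (Perrin-Riou 1987, Thm. 1.1;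
Perrin-Riou 1988; Nekovář 1995, (0.5), Thm. 5.10) through the interpolation predicate
`IsTwoVariablePAdicLFunctionK ι W κ f F` (`F ∈ ℚ_p⟦T⟧⟦S⟧` BOUNDED, with prescribed values at the
points `(ψ(γ₀) - 1, e(1) - 1)` of the finite-order characters `(ψ, e)` of `Γ × Gal(K_∞/K)`),
defines `twoVariablePAdicLFunctionK` as THE series with the predicate if there is exactly one
(junk `0` otherwise), and records existence AND uniqueness as ONE named fact
`existsUnique_isTwoVariablePAdicLFunctionK` (uniqueness: "Weierstrass preparation", folklore).
This file PROVES the uniqueness half: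
* `eq_zero_of_isBoundedCycAnti_of_forall_hasValueAt_zero` — **two-variable uniqueness principle**:
  a bounded `H ∈ ℚ_p⟦T⟧⟦S⟧` vanishing at all `(ξ - 1, ξ' - 1)`, `ξ, ξ' ∈ μ_{p^∞}(ℂ_p)`, is `0`
  (fiberwise summation + two applications of the tree's one-variable principle over `ℂ_p`,
  `eq_zero_of_bounded_of_forall_hasSum_rootOfUnity_sub_one`, which uses ALL roots of unity of each
  level and so needs no discreteness of the coefficients);
* `exists_even_character_apply_cyclotomicGenerator_eq` — for ANY commutative ring `R ∋ ζ` with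
  `ζ^{p^{j+1}} = 1`, an even `p`-power-order Dirichlet character mod `p^{j+1+e₀}` with values in
  `R` and `χ(γ₀) = ζ` (the tree's construction `exists_character_apply_cyclotomicGenerator_eq`,
  there for `R = ℂ_p` and primitive `ζ`); `exists_mem_integralClosure_algToPadic_eq` and its two
  corollaries — along `ι : ℚ̄ → ℂ_p` every `p`-power root of unity of `ℂ_p` is `ι(e(1))` and
  `ι(ψ(γ₀))` for `ℂ`-valued characters `e`, `ψ` as in the predicate;
* `IsTwoVariablePAdicLFunctionK.unique` — two series with the interpolation property are EQUAL
  (no hypothesis on `p, W, K, κ, f`); hence `∃! ↔ ∃`, the definition returns any interpolant that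
  exists (its junk locus is the non-existence locus), the named fact is EQUIVALENT to the printed
  existence statement (`existsUnique_isTwoVariablePAdicLFunctionK_iff`), and the named facts
  `cycRestrict_twoVariablePAdicLFunctionK_eq` / `antiRestrict_twoVariablePAdicLFunctionK_eq_zero`
  about the DEFINED series hold for EVERY interpolant (the predicate-quantified shape).

## References
* B. Perrin-Riou, Invent. Math. 89 (1987), 455–510, Thm. 1.1, (1.1), Rem. 1.4 [PerrinRiou1987];
  J. London Math. Soc. (2) 38 (1988), 1–32, Prop. 29 [PerrinRiou1988].
* J. Nekovář, Math. Ann. 302 (1995), 609–686: (0.5), Thm. 5.10, Cor. of Prop. 5.12, (5.13.4)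
  [Nekovar1995].
* B. Mazur, J. Tate, J. Teitelbaum, Invent. Math. 84 (1986), 1–48, §I.11–§I.14
  [MazurTateTeitelbaum1986Invent]; L. C. Washington, *Introduction to cyclotomic fields*, §7.2.
-/

noncomputable section

open Filter Topology
open scoped MatrixGroups ModularForm
open CongruenceSubgroup NumberField IsDedekindDomain Field
open Literature.NumberTheory.GaloisRepresentations
open Literature.NumberTheory.EllipticCurves.ModularForms

namespace Literature.NumberTheory.EllipticCurves

variable {p : ℕ} [Fact p.Prime]

section Analysis

/-- Bounded two-variable series are closed under subtraction (`‖a - b‖ ≤ ‖a‖ + ‖b‖`;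
`ℤ_p⟦ℤ_p²⟧ ⊗ ℚ_p` is a ring — Mazur–Tate–Teitelbaum 1986, §I.12 in one variable).
[cite: MazurTateTeitelbaum1986Invent, §I.12] -/
theorem IsBoundedCycAnti.sub {F G : CycAntiSeries p} (hF : IsBoundedCycAnti F)
    (hG : IsBoundedCycAnti G) : IsBoundedCycAnti (F - G) := by
  obtain ⟨⟨C, hC⟩, ⟨C', hC'⟩⟩ := And.intro hF hG
  refine ⟨C + C', fun j k ↦ ?_⟩
  rw [map_sub, map_sub]; exact (norm_sub_le _ _).trans (add_le_add (hC j k) (hC' j k))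

/-- Values are compatible with subtraction: `(F - G)(x, y) = F(x, y) - G(x, y)` (evaluation at a
point of the open bidisc is additive; Mazur–Tate–Teitelbaum 1986, §I.13 in one variable).
[cite: MazurTateTeitelbaum1986Invent, §I.13] -/
theorem HasValueAt.sub {F G : CycAntiSeries p} {x y v w : ℂ_[p]} (hF : HasValueAt F x y v)
    (hG : HasValueAt G x y w) : HasValueAt (F - G) x y (v - w) := by
  unfold HasValueAt at hF hG ⊢
  exact (hF.sub hG).congr_fun fun jk ↦ by rw [map_sub, map_sub, map_sub, sub_mul, sub_mul]

/-- For coefficients bounded by `C` and `‖y‖ < 1`, each fiberwise series `∑_k a_{jk} y^k`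
(`a_{jk} = [T^k S^j] H` sent to `ℂ_p`) converges … [folklore] -/
private theorem summable_coeff_coeff_mul_pow {H : CycAntiSeries p} {C : ℝ}
    (hC : ∀ j k, ‖PowerSeries.coeff k (PowerSeries.coeff j H)‖ ≤ C) (j : ℕ) {y : ℂ_[p]}
    (hy : ‖y‖ < 1) :
    Summable fun k ↦
      algebraMap ℚ_[p] ℂ_[p] (PowerSeries.coeff k (PowerSeries.coeff j H)) * y ^ k :=
  summable_map_coeff_mul_pow (algebraMap ℚ_[p] ℂ_[p]) (A := PowerSeries.coeff j H) (C := C)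
    (fun k ↦ by rw [norm_algebraMap']; exact hC j k) hy

/-- … and its sum is again bounded by `C` (ultrametric inequality, `‖y‖ ≤ 1`). [folklore] -/
private theorem norm_tsum_coeff_coeff_mul_pow_le {H : CycAntiSeries p} {C : ℝ}
    (hC : ∀ j k, ‖PowerSeries.coeff k (PowerSeries.coeff j H)‖ ≤ C) (j : ℕ) {y : ℂ_[p]}
    (hy : ‖y‖ < 1) :
    ‖∑' k, algebraMap ℚ_[p] ℂ_[p] (PowerSeries.coeff k (PowerSeries.coeff j H)) * y ^ k‖ ≤ C := by
  have hC0 : 0 ≤ C := (norm_nonneg _).trans (hC 0 0)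
  refine IsUltrametricDist.norm_tsum_le_of_forall_le_of_nonneg hC0 fun k ↦ ?_
  rw [norm_mul, norm_pow, norm_algebraMap']
  calc ‖PowerSeries.coeff k (PowerSeries.coeff j H)‖ * ‖y‖ ^ k ≤ C * 1 :=
        mul_le_mul (hC j k) (pow_le_one₀ (norm_nonneg _) hy.le) (pow_nonneg (norm_nonneg _) _) hC0
    _ = C := mul_one C

/-- **Two-variable uniqueness principle for bounded series.** A bounded `H ∈ ℚ_p⟦T⟧⟦S⟧`
(`∈ ℤ_p⟦ℤ_p²⟧ ⊗ ℚ_p`) whose value at `(S, T) = (ξ - 1, ξ' - 1)` is `0` for all `p`-power roots of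
unity `ξ, ξ' ∈ ℂ_p` is `0` (a bounded measure on `ℤ_p²` with vanishing integrals against all
finite-order characters is zero; Mazur–Tate–Teitelbaum 1986, §I.11–I.14 in one variable): the
one-variable principle over `ℂ_p` (`eq_zero_of_bounded_of_forall_hasSum_rootOfUnity_sub_one`)
applied to `∑_j c_j(ξ' - 1) S^j`, `c_j(y) = ∑_k [T^k S^j]H · y^k`, then to each `[S^j]H`.
[cite: MazurTateTeitelbaum1986Invent, §I.11 and §I.14 (14.3)] -/
theorem eq_zero_of_isBoundedCycAnti_of_forall_hasValueAt_zero {H : CycAntiSeries p}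
    (hb : IsBoundedCycAnti H)
    (h : ∀ (m n : ℕ) (ξ ξ' : ℂ_[p]), ξ ^ p ^ m = 1 → ξ' ^ p ^ n = 1 →
      HasValueAt H (ξ - 1) (ξ' - 1) 0) :
    H = 0 := by
  obtain ⟨C, hC⟩ := hb
  have key : ∀ (n : ℕ) (ξ' : ℂ_[p]), ξ' ^ p ^ n = 1 → ∀ j : ℕ,
      ∑' k, algebraMap ℚ_[p] ℂ_[p] (PowerSeries.coeff k (PowerSeries.coeff j H)) *
        (ξ' - 1) ^ k = 0 := by
    intro n ξ' hξ'
    have hy : ‖ξ' - 1‖ < 1 := norm_sub_one_lt_one_of_pow_prime_pow_eq_one hξ'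
    set c : ℕ → ℂ_[p] := fun j ↦ ∑' k,
      algebraMap ℚ_[p] ℂ_[p] (PowerSeries.coeff k (PowerSeries.coeff j H)) * (ξ' - 1) ^ k with hc
    have hzero : PowerSeries.mk c = 0 := by
      refine eq_zero_of_bounded_of_forall_hasSum_rootOfUnity_sub_one (C := C) (fun j ↦ ?_)
        fun m ξ hξ ↦ ?_
      · rw [PowerSeries.coeff_mk]; exact norm_tsum_coeff_coeff_mul_pow_le hC j hy
      · have hfib : ∀ j : ℕ, HasSum (fun k : ℕ ↦
            algebraMap ℚ_[p] ℂ_[p] (PowerSeries.coeff k (PowerSeries.coeff j H)) *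
              (ξ - 1) ^ j * (ξ' - 1) ^ k) ((ξ - 1) ^ j * c j) := fun j ↦
          (((summable_coeff_coeff_mul_pow hC j hy).hasSum).mul_left ((ξ - 1) ^ j)).congr_fun
            fun k ↦ by ring
        exact (HasSum.prod_fiberwise (h m n ξ ξ' hξ hξ') hfib).congr_fun fun j ↦ by
          rw [PowerSeries.coeff_mk]; exact mul_comm _ _
    intro j
    simpa only [PowerSeries.coeff_mk, map_zero, hc] using congr_arg (PowerSeries.coeff j) hzero
  -- now each `[S^j] H ∈ ℚ_p⟦T⟧` vanishes at every `ξ' - 1`, hence is `0`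
  refine PowerSeries.ext fun j ↦ PowerSeries.ext fun k ↦ ?_
  rw [map_zero, map_zero]
  have hFj : PowerSeries.map (algebraMap ℚ_[p] ℂ_[p]) (PowerSeries.coeff j H) = 0 := by
    refine eq_zero_of_bounded_of_forall_hasSum_rootOfUnity_sub_one (C := C) (fun k ↦ ?_)
      fun n ξ' hξ' ↦ ?_
    · rw [PowerSeries.coeff_map, norm_algebraMap']; exact hC j k
    · have hs := (summable_coeff_coeff_mul_pow hC j
        (norm_sub_one_lt_one_of_pow_prime_pow_eq_one hξ')).hasSum
      rw [key n ξ' hξ' j] at hs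
      exact hs.congr_fun fun k ↦ by rw [PowerSeries.coeff_map]
  have hk := congr_arg (PowerSeries.coeff k) hFj
  rw [PowerSeries.coeff_map, map_zero] at hk
  exact (map_eq_zero_iff _ (algebraMap ℚ_[p] ℂ_[p]).injective).mp hk

end Analysis

section Characters

/-- **Every `ζ` with `ζ^{p^{j+1}} = 1` is `χ(γ₀)` for an even character `χ` of `p`-power order**
modulo `p^{j+1+e₀}` with values in any commutative ring `R ∋ ζ` (`γ₀ = 1 + p^{e₀}`): on
`(ℤ/p^{j+1+e₀})^× = μ_τ × ⟨γ₀⟩` (tree: `classMap_injective`, `card_classDomain`, `classMap_mul`)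
set `χ(η γ₀^s) = ζ^s` — the construction of the tree's
`exists_character_apply_cyclotomicGenerator_eq` (there: target `ℂ_p`, primitive `ζ` and `χ`) for
a general target, without primitivity (Washington §7.2; Mazur–Tate–Teitelbaum 1986, §I.13).
[cite: MazurTateTeitelbaum1986Invent, §I.13] -/
theorem exists_even_character_apply_cyclotomicGenerator_eq {R : Type*} [CommRing R] (j : ℕ)
    {ζ : R} (hζ1 : ζ ^ p ^ (j + 1) = 1) :
    ∃ χ : DirichletCharacter R (p ^ (j + 1 + cyclotomicExponent p)),
      χ.Even ∧ (∃ i : ℕ, orderOf χ = p ^ i) ∧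
        χ (cyclotomicGenerator p : ZMod (p ^ (j + 1 + cyclotomicExponent p))) = ζ := by
  classical
  have hp : p.Prime := Fact.out
  haveI := neZero_torsionOrder p
  haveI := Fintype.ofFinite (rootsOfUnity (torsionOrder p) ℤ_[p])
  haveI : NeZero (p ^ (j + 1)) := ⟨pow_ne_zero _ hp.ne_zero⟩
  haveI : NeZero (p ^ (j + 1 + cyclotomicExponent p)) := ⟨pow_ne_zero _ hp.ne_zero⟩
  haveI : Fact (1 < p ^ (j + 1)) := ⟨Nat.one_lt_pow (by omega) hp.one_lt⟩
  -- the bijection `Φ : μ_τ × ℤ/p^{j+1} → (ℤ/p^{j+1+e₀})^×`, `(η, s) ↦ η γ₀^s`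
  set Φ : rootsOfUnity (torsionOrder p) ℤ_[p] × ZMod (p ^ (j + 1)) →
      (ZMod (p ^ (j + 1 + cyclotomicExponent p)))ˣ := fun x ↦ (isUnit_classMap p (j + 1) x).unit
    with hΦ_def
  have hΦval : ∀ x, (Φ x : ZMod (p ^ (j + 1 + cyclotomicExponent p))) =
      PadicInt.toZModPow (j + 1 + cyclotomicExponent p) ((x.1 : ℤ_[p]ˣ) : ℤ_[p]) *
        (cyclotomicGenerator p : ZMod (p ^ (j + 1 + cyclotomicExponent p))) ^ x.2.val := fun x ↦
    IsUnit.unit_spec _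
  have hΦinj : Function.Injective Φ := fun x y hxy ↦ classMap_injective p (j + 1) (by
    simpa only [hΦval] using congr_arg Units.val hxy)
  have hΦbij : Function.Bijective Φ :=
    (Fintype.bijective_iff_injective_and_card Φ).mpr ⟨hΦinj, card_classDomain p (j + 1)⟩
  have hΦmul : ∀ x y, Φ (x.1 * y.1, x.2 + y.2) = Φ x * Φ y := fun x y ↦ by
    ext; rw [Units.val_mul, hΦval, hΦval, hΦval]
    exact classMap_mul p (j + 1) x.1 y.1 x.2 y.2
  set E := Equiv.ofBijective Φ hΦbij
  have hE : ∀ x, E x = Φ x := fun x ↦ rfl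
  have hEsymm_mul : ∀ u v,
      E.symm (u * v) = ((E.symm u).1 * (E.symm v).1, (E.symm u).2 + (E.symm v).2) :=
    fun u v ↦ E.injective (by
      rw [Equiv.apply_symm_apply, hE, hΦmul, ← hE, ← hE, Equiv.apply_symm_apply,
        Equiv.apply_symm_apply])
  have hEsymm_one : E.symm 1 = (1, 0) := E.injective (by
    rw [Equiv.apply_symm_apply, hE]; ext
    rw [hΦval, Units.val_one]; exact (classMap_one p (j + 1)).symm)
  set ζu : Rˣ := (IsUnit.of_pow_eq_one hζ1 (pow_ne_zero _ hp.ne_zero)).unit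
  have hζu : (ζu : R) = ζ := IsUnit.unit_spec _
  have hζu1 : ζu ^ p ^ (j + 1) = 1 := Units.ext (by
    rw [Units.val_pow_eq_pow_val, hζu, hζ1, Units.val_one])
  let g : (ZMod (p ^ (j + 1 + cyclotomicExponent p)))ˣ →* Rˣ :=
    { toFun := fun u ↦ ζu ^ (E.symm u).2.val
      map_one' := by rw [hEsymm_one, ZMod.val_zero, pow_zero]
      map_mul' := fun u v ↦ by
        rw [hEsymm_mul, ZMod.val_add, ← pow_eq_pow_mod _ hζu1, pow_add] }
  have hg : ∀ u, g u = ζu ^ (E.symm u).2.val := fun u ↦ rfl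
  set χ : DirichletCharacter R (p ^ (j + 1 + cyclotomicExponent p)) := MulChar.ofUnitHom g
    with hχ_def
  have hχapply : ∀ x, χ ((Φ x : (ZMod (p ^ (j + 1 + cyclotomicExponent p)))ˣ) :
      ZMod (p ^ (j + 1 + cyclotomicExponent p))) = ζ ^ x.2.val := fun x ↦ by
    rw [hχ_def, MulChar.ofUnitHom_coe, hg, ← hE, Equiv.symm_apply_apply, Units.val_pow_eq_pow_val,
      hζu]
  have hγ : (Φ (1, 1) : ZMod (p ^ (j + 1 + cyclotomicExponent p))) =
      (cyclotomicGenerator p : ZMod (p ^ (j + 1 + cyclotomicExponent p))) := by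
    rw [hΦval, OneMemClass.coe_one, Units.val_one, map_one, one_mul, ZMod.val_one, pow_one]
  have hχγ : χ (cyclotomicGenerator p : ZMod (p ^ (j + 1 + cyclotomicExponent p))) = ζ := by
    rw [← hγ, hχapply, ZMod.val_one, pow_one]
  refine ⟨χ, ?_, ?_, hχγ⟩
  · have hm1 : (Φ (⟨-1, neg_one_mem_rootsOfUnity_torsionOrder p⟩, 0) :
        ZMod (p ^ (j + 1 + cyclotomicExponent p))) = -1 := by
      rw [hΦval]; exact classMap_neg_one p (j + 1)
    show χ (-1) = 1
    rw [← hm1, hχapply, ZMod.val_zero, pow_zero]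
  · have hpow : χ ^ p ^ (j + 1) = 1 := by
      refine MulChar.ext fun a ↦ ?_
      obtain ⟨x, rfl⟩ := hΦbij.2 a
      rw [MulChar.pow_apply_coe, MulChar.one_apply_coe, hχapply, ← pow_mul, mul_comm, pow_mul, hζ1,
        one_pow]
    exact ((Nat.dvd_prime_pow hp).mp (orderOf_dvd_of_pow_eq_one hpow)).imp fun i hi ↦ hi.2

end Characters

section Transport

/-- **Every `p`-power root of unity `ξ` of `ℂ_p` comes from `ℚ̄ ⊂ ℂ` along `ι`** (the embedding
datum `ι : ℚ̄ = integralClosure ℚ ℂ → ℂ_p` of `TwoVariablePAdicLFunctionK.lean`):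
`ξ = algToPadic ι ζ` with `ζ ∈ ℂ` algebraic, `ζ^{p^n} = 1` — `ι` maps `exp(2πi/p^n) ∈ ℚ̄` to a root
of `Φ_{p^n}` in `ℂ_p`, i.e. to a PRIMITIVE `p^n`-th root of unity, whose powers exhaust
`μ_{p^n}(ℂ_p)`. [folklore] -/
private theorem exists_mem_integralClosure_algToPadic_eq (ι : integralClosure ℚ ℂ →+* ℂ_[p]) (n : ℕ)
    {ξ : ℂ_[p]} (hξ : ξ ^ p ^ n = 1) :
    ∃ ζ : ℂ, ζ ∈ integralClosure ℚ ℂ ∧ ζ ^ p ^ n = 1 ∧ algToPadic ι ζ = ξ := by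
  have hk : p ^ n ≠ 0 := pow_ne_zero _ (Fact.out : p.Prime).ne_zero
  haveI : NeZero (p ^ n) := ⟨hk⟩
  set ζ₀ : ℂ := Complex.exp (2 * Real.pi * Complex.I / (p ^ n : ℕ))
  have hζ₀ : IsPrimitiveRoot ζ₀ (p ^ n) := Complex.isPrimitiveRoot_exp (p ^ n) hk
  have hint : IsIntegral ℚ ζ₀ :=
    IsIntegral.of_pow (Nat.pos_of_ne_zero hk) (by rw [hζ₀.pow_eq_one]; exact isIntegral_one)
  set x₀ : integralClosure ℚ ℂ := ⟨ζ₀, (mem_integralClosure_iff ℚ ℂ).mpr hint⟩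
  have hval : algebraMap (integralClosure ℚ ℂ) ℂ
      (Polynomial.eval x₀ (Polynomial.cyclotomic (p ^ n) (integralClosure ℚ ℂ))) = 0 := by
    rw [← Polynomial.eval₂_hom, ← Polynomial.eval_map, Polynomial.map_cyclotomic]
    exact (Polynomial.isRoot_cyclotomic_iff.mpr hζ₀).eq_zero
  have hroot₀ := (map_eq_zero_iff _ (FaithfulSMul.algebraMap_injective _ _)).mp hval
  have hroot : (Polynomial.cyclotomic (p ^ n) ℂ_[p]).IsRoot (ι x₀) := by
    rw [Polynomial.IsRoot.def, ← Polynomial.map_cyclotomic (p ^ n) ι, Polynomial.eval_map,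
      Polynomial.eval₂_hom, hroot₀, map_zero]
  have hprim : IsPrimitiveRoot (ι x₀) (p ^ n) := Polynomial.isRoot_cyclotomic_iff.mp hroot
  obtain ⟨i, -, hi⟩ := hprim.eq_pow_of_pow_eq_one hξ
  refine ⟨ζ₀ ^ i, Subalgebra.pow_mem _ x₀.2 i, ?_, ?_⟩
  · rw [← pow_mul, mul_comm, pow_mul, hζ₀.pow_eq_one, one_pow]
  · rw [algToPadic_of_mem ι (Subalgebra.pow_mem _ x₀.2 i), ← hi, ← map_pow]; rfl

/-- Along `ι`, every `p`-power root of unity `ξ ∈ ℂ_p` is `ι(e(1))` for an additive character `e`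
of `ℤ/p^{n+1}` with values in `ℂ` (`e = (a ↦ ζ^a)`, Mathlib `AddChar.zmodChar`). [folklore] -/
private theorem exists_addChar_algToPadic_apply_one_eq (ι : integralClosure ℚ ℂ →+* ℂ_[p]) (n : ℕ)
    {ξ : ℂ_[p]} (hξ : ξ ^ p ^ n = 1) :
    ∃ e : AddChar (ZMod (p ^ (n + 1))) ℂ, algToPadic ι (e 1) = ξ := by
  have hp : p.Prime := Fact.out
  haveI : NeZero (p ^ (n + 1)) := ⟨pow_ne_zero _ hp.ne_zero⟩
  haveI : Fact (1 < p ^ (n + 1)) := ⟨Nat.one_lt_pow (by omega) hp.one_lt⟩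
  have hξ' : ξ ^ p ^ (n + 1) = 1 := by rw [pow_succ, pow_mul, hξ, one_pow]
  obtain ⟨ζ, -, hζ1, hζ⟩ := exists_mem_integralClosure_algToPadic_eq ι (n + 1) hξ'
  exact ⟨AddChar.zmodChar _ hζ1, by rw [AddChar.zmodChar_apply, ZMod.val_one, pow_one, hζ]⟩

/-- Along `ι`, every `p`-power root of unity `ξ ∈ ℂ_p` is `ι(ψ(γ₀))` for an even Dirichlet
character `ψ` of `p`-power order modulo `p^{n+1+e₀}` with values in `ℂ` — so every
`(ξ - 1, ξ' - 1)` is an interpolation point of `IsTwoVariablePAdicLFunctionK`.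
[cite: MazurTateTeitelbaum1986Invent, §I.13] -/
theorem exists_dirichletCharacter_algToPadic_apply_eq (ι : integralClosure ℚ ℂ →+* ℂ_[p]) (n : ℕ)
    {ξ : ℂ_[p]} (hξ : ξ ^ p ^ n = 1) :
    ∃ ψ : DirichletCharacter ℂ (p ^ (n + 1 + cyclotomicExponent p)),
      ψ.Even ∧ (∃ i : ℕ, orderOf ψ = p ^ i) ∧
        algToPadic ι (ψ (cyclotomicGenerator p : ZMod (p ^ (n + 1 + cyclotomicExponent p)))) =
          ξ := by
  have hξ' : ξ ^ p ^ (n + 1) = 1 := by rw [pow_succ, pow_mul, hξ, one_pow]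
  obtain ⟨ζ, -, hζ1, hζ⟩ := exists_mem_integralClosure_algToPadic_eq ι (n + 1) hξ'
  obtain ⟨ψ, heven, hord, hψ⟩ := exists_even_character_apply_cyclotomicGenerator_eq (R := ℂ) n hζ1
  exact ⟨ψ, heven, hord, by rw [hψ, hζ]⟩

end Transport

section Uniqueness

variable {K : Type*} [Field K] [NumberField K] {N : ℕ} [NeZero N]
  {ι : integralClosure ℚ ℂ →+* ℂ_[p]} {W : WeierstrassCurve ℚ} [W.IsGloballyMinimal]
  {κ : ZpExtension K p} {f : CuspForm (Gamma0 N) 2}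

/-- **Uniqueness of the two-variable `p`-adic `L`-function.** Two series `F, G ∈ ℚ_p⟦T⟧⟦S⟧` with
the interpolation property `IsTwoVariablePAdicLFunctionK ι W κ f` (bounded; Nekovář's values (0.5)
at all finite-order characters of `Γ × Gal(K_∞/K)`) are EQUAL, for every `p, W, K, κ, f, ι`:
`F - G` is bounded and vanishes at every `(ξ - 1, ξ' - 1)`, `ξ, ξ' ∈ μ_{p^∞}(ℂ_p)` (all of which are
interpolation points, where `F` and `G` take the same prescribed value). The uniqueness half of the
named fact `existsUnique_isTwoVariablePAdicLFunctionK`, now a theorem.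
[cite: MazurTateTeitelbaum1986Invent, §I.11 and §I.14 (14.3)] -/
theorem IsTwoVariablePAdicLFunctionK.unique {F G : CycAntiSeries p}
    (hF : IsTwoVariablePAdicLFunctionK ι W κ f F) (hG : IsTwoVariablePAdicLFunctionK ι W κ f G) :
    F = G := by
  rw [← sub_eq_zero]
  refine eq_zero_of_isBoundedCycAnti_of_forall_hasValueAt_zero (hF.1.sub hG.1)
    fun m n ξ ξ' hξ hξ' ↦ ?_
  obtain ⟨ψ, hψe, hψo, hψ⟩ := exists_dirichletCharacter_algToPadic_apply_eq ι m hξ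
  obtain ⟨e, he⟩ := exists_addChar_algToPadic_apply_one_eq ι n hξ'
  have h1 := hF.2 (m + 1 + cyclotomicExponent p) (n + 1) ψ hψe hψo e
  have h2 := hG.2 (m + 1 + cyclotomicExponent p) (n + 1) ψ hψe hψo e
  rw [hψ, he] at h1 h2
  exact sub_self (algToPadic ι _ * _) ▸ h1.sub h2

/-- `∃!` is `∃` for the interpolation property (pointwise in all parameters).
[cite: MazurTateTeitelbaum1986Invent, §I.14 (14.3)] -/
theorem existsUnique_iff_exists_isTwoVariablePAdicLFunctionK :
    (∃! F : CycAntiSeries p, IsTwoVariablePAdicLFunctionK ι W κ f F) ↔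
      ∃ F : CycAntiSeries p, IsTwoVariablePAdicLFunctionK ι W κ f F :=
  ⟨fun h ↦ h.exists, fun ⟨F, hF⟩ ↦ ⟨F, hF, fun _ hG ↦ hG.unique hF⟩⟩

/-- **The definition returns any interpolant that exists**: `twoVariablePAdicLFunctionK ι W κ hf`
is `F` for every `F` with the interpolation property (the junk locus of the definition is exactly
the NON-EXISTENCE locus). [cite: Nekovar1995, (0.5) p. 611] -/
theorem twoVariablePAdicLFunctionK_eq_of_isTwoVariablePAdicLFunctionK (hf : IsNewformOf W f)
    {F : CycAntiSeries p} (hF : IsTwoVariablePAdicLFunctionK ι W κ f F) :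
    twoVariablePAdicLFunctionK ι W κ hf = F :=
  (hF.eq_twoVariablePAdicLFunctionK hf
    (existsUnique_iff_exists_isTwoVariablePAdicLFunctionK.mpr ⟨F, hF⟩)).symm

end Uniqueness

section NamedFacts

/-- **The named fact `existsUnique_isTwoVariablePAdicLFunctionK` is equivalent to bare
EXISTENCE** — the statement actually printed: under the standing hypotheses, "`L_p(f ⊗ K, 𝒞)` …
is an Iwasawa function" with the interpolation property (0.5) (Nekovář 1995, Thm. 5.10 after
Perrin-Riou 1988, Prop. 29; weight two: Perrin-Riou 1987, Thm. 1.1 "Il existe … un élément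
`L_p(f, 𝒞)` de `d^{-1} Iw(k_∞/k) ⊗ 𝒪_F(𝒞)` tel que …"); uniqueness is the theorem
`IsTwoVariablePAdicLFunctionK.unique`. [cite: Nekovar1995, (0.5) p. 611 and Thm. 5.10] -/
theorem existsUnique_isTwoVariablePAdicLFunctionK_iff :
    existsUnique_isTwoVariablePAdicLFunctionK ↔
      ∀ {p : ℕ} [Fact p.Prime] (ι : integralClosure ℚ ℂ →+* ℂ_[p]) (W : WeierstrassCurve ℚ)
        [W.IsElliptic] [W.IsGloballyMinimal] (K : Type) [Field K] [NumberField K]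
        (κ : ZpExtension K p) {N : ℕ} [NeZero N] {f : CuspForm (Gamma0 N) 2}
        (_ : IsNewformOf W f),
        p ≠ 2 → ¬ p ∣ N → IsImaginaryQuadratic K → Odd (NumberField.discr K) →
        SatisfiesHeegnerHypothesis N K → ((Ideal.span {(p : ℤ)}).primesOver (𝓞 K)).ncard = 2 →
        IsOrdinaryAt W p → κ.IsAnticyclotomic →
        ∃ F : CycAntiSeries p, IsTwoVariablePAdicLFunctionK ι W κ f F := by
  constructor <;> intro h p _ ι W _ _ K _ _ κ N _ f hf hp hpN hK hodd hH hsplit hord hκ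
  · exact (h ι W K κ hf hp hpN hK hodd hH hsplit hord hκ).exists
  · exact existsUnique_iff_exists_isTwoVariablePAdicLFunctionK.mpr
      (h ι W K κ hf hp hpN hK hodd hH hsplit hord hκ)

/-- **The cyclotomic restriction property holds for EVERY interpolant** (predicate-quantified
shape of `cycRestrict_twoVariablePAdicLFunctionK_eq`; any interpolant IS the defined series):
`cycRestrict F = C · (1+S)^a · L_p(f, α, S) L_p(g, α', S)`, `C ≠ 0` (Nekovář 1995, (5.13.4);
Perrin-Riou 1987, (1.1)). [cite: Nekovar1995, (5.13.4) p. 636] -/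
theorem cycRestrict_eq_of_isTwoVariablePAdicLFunctionK
    (h : cycRestrict_twoVariablePAdicLFunctionK_eq) {p : ℕ} [Fact p.Prime]
    (ι : integralClosure ℚ ℂ →+* ℂ_[p]) (W : WeierstrassCurve ℚ) [W.IsElliptic]
    [W.IsGloballyMinimal] (K : Type) [Field K] [NumberField K] (κ : ZpExtension K p)
    {N N' : ℕ} [NeZero N] [NeZero N']
    {f : CuspForm (Gamma0 N) 2} {g : CuspForm (Gamma0 N') 2}
    (hf : IsNewformOf W f) (hg : IsNewformOf (W.quadraticTwist (NumberField.discr K : ℚ)) g)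
    (hp : p ≠ 2) (hpN : ¬ p ∣ N) (hK : IsImaginaryQuadratic K) (hodd : Odd (NumberField.discr K))
    (hH : SatisfiesHeegnerHypothesis N K)
    (hsplit : ((Ideal.span {(p : ℤ)}).primesOver (𝓞 K)).ncard = 2) (hord : IsOrdinaryAt W p)
    (hκ : κ.IsAnticyclotomic) {F : CycAntiSeries p} (hF : IsTwoVariablePAdicLFunctionK ι W κ f F) :
    ∃ (C : ℚ_[p]) (a : ℤ_[p]), C ≠ 0 ∧
      cycRestrict F =
        PowerSeries.C C * PowerSeries.binomialSeries ℚ_[p] a * padicLFunctionEK W p K hf hg := by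
  rw [← twoVariablePAdicLFunctionK_eq_of_isTwoVariablePAdicLFunctionK hf hF]
  exact h ι W K κ hf hg hp hpN hK hodd hH hsplit hord hκ

/-- **The anticyclotomic vanishing holds for EVERY interpolant** (predicate-quantified shape of
`antiRestrict_twoVariablePAdicLFunctionK_eq_zero`): `antiRestrict F = 0` (Perrin-Riou 1987,
Rem. 1.4; Nekovář 1995, Cor. of Prop. 5.12). [cite: Nekovar1995, Cor. of Prop. 5.12 (p. 635)] -/
theorem antiRestrict_eq_zero_of_isTwoVariablePAdicLFunctionK
    (h : antiRestrict_twoVariablePAdicLFunctionK_eq_zero)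
    {p : ℕ} [Fact p.Prime] (ι : integralClosure ℚ ℂ →+* ℂ_[p]) (W : WeierstrassCurve ℚ)
    [W.IsElliptic] [W.IsGloballyMinimal] (K : Type) [Field K] [NumberField K]
    (κ : ZpExtension K p) {N : ℕ} [NeZero N] {f : CuspForm (Gamma0 N) 2}
    (hf : IsNewformOf W f) (hp : p ≠ 2) (hpN : ¬ p ∣ N) (hK : IsImaginaryQuadratic K)
    (hodd : Odd (NumberField.discr K)) (hH : SatisfiesHeegnerHypothesis N K)
    (hsplit : ((Ideal.span {(p : ℤ)}).primesOver (𝓞 K)).ncard = 2) (hord : IsOrdinaryAt W p)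
    (hκ : κ.IsAnticyclotomic) {F : CycAntiSeries p} (hF : IsTwoVariablePAdicLFunctionK ι W κ f F) :
    antiRestrict F = 0 := by
  rw [← twoVariablePAdicLFunctionK_eq_of_isTwoVariablePAdicLFunctionK hf hF]
  exact h ι W K κ hf hp hpN hK hodd hH hsplit hord hκ

end NamedFacts

end Literature.NumberTheory.EllipticCurves

end
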